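import Summits.AnomalousDissipation.AnomalousDissipation.Theorems.SawtoothPulseCascadeK1LocalisedCascadeColumnBound
import Summits.AnomalousDissipation.AnomalousDissipation.Theorems.SawtoothPulseCascadeK1LocalisedCascadeLineRefineCascadeLt

/-!
# K1loc, line `Spectral` — S-D (first good piece): LINE MEANS AND OFF-COLUMN COEFFICIENTS, SMALLNESS ONLY AT THE PHASES `j < n`

Helper file of the prover lane on the crux `K1LocalisedCascade` (stmt-AnomalousDissipation-19491), route
`SawtoothPulseCascade`, registered line `Cruxes.K1LocalisedCascade.Spectral` (one open stub `stub_highModeConcentration`).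
`…ColumnBound` §3 re-derived from `…LineRefineCascadeLt.chord_sum_le_lt`: the zone inequalities are asked only for `j < n`
(the `∀ j` form of `…ColumnBound` forces `E = 0`).  Same statements otherwise:
`chord_sum_le_axisAvg_lt`, `abs_axisAvg_iterate_le_lt` (`|axisAvg 0 (a_n) x| ≤ B_n/π + 2πE_V + axisAvg 0 1_{Bad} x`),
`norm_mFourierCoeff_iterate_le_lt` (`‖𝓕(a_n)(k)‖ ≤ B_n/(π(1 − |k₀|(γ²−3)^{−n})) + 2πE_V + vol(Bad)`).
[cite: ElgindiLissMattingly2025, §1.2.2, §3.1] [cite: Grafakos2014, Prop. 3.1.2] [problem: turb]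
-/

-- `Summit.<Summit>.<Problem>`: single-conjunct summit, the duplicate namespace segment is deliberate.
set_option linter.dupNamespace false

noncomputable section

namespace Summit.AnomalousDissipation.AnomalousDissipation.Theorems.SawtoothPulseCascade.K1Start

open Set Function MeasureTheory Complex UnitAddTorus intervalIntegral
open scoped ENNReal
open Literature.Analysis Literature.Analysis.FunctionSpaces Literature.Analysis.FunctionSpaces.Torus
open Literature.Analysis.FluidPDE.ShearStage
open Literature.Analysis.FluidPDE.SawtoothCascade Literature.Analysis.FluidPDE.SawtoothCascade.CascadeParams

/-! ## §3 The section of the bad set and the line means -/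

section Means

variable (P : CascadeParams)

/-- **The near-corner parameters of a chord have small measure in mean**: with `Bad` as in `…BadSetChord.exists_badSet`, for every chord
the chord sum bound of `…ChordPhase.chord_sum_le` is at most `B_n/(π(1 − |m|(γ²−3)^{−n})) + 2πE_V + axisAvg 0 1_{Bad} (proj Y)`.
[cite: ElgindiLissMattingly2025, §1.2.2, §3.1] -/
theorem chord_sum_le_axisAvg_lt (hγ : 1 ≤ P.γ) (h8 : 8 ≤ P.γ ^ 2) (hδ₀ : 0 < P.δ₀) (hd : 0 < P.d) (hN₀ : 1 ≤ P.N₀) (hρ : 1 ≤ P.ρN)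
    {M₁ M₂ : ℝ} (hM₁ : 0 < M₁) (hM : 1 ≤ M₂) (hMδ : ∀ j, M₂ * P.δ j < Real.pi / 2) {n : ℕ}
    {EV EH : ℝ} (B : ℕ → ℝ) (hEV0 : 0 ≤ EV)
    (hEV : ∀ ℓ, ℓ ≤ n → (∑ i ∈ Finset.range ℓ, (1 + P.γ + P.γ ^ 2) ^ i *
        ((P.γ ^ 2 * (1 / (2 * P.N (n - ℓ + i)) - M₂ * P.δ (n - ℓ + i) / (Real.pi * P.N (n - ℓ + i))) +
          P.γ * (1 / (2 * P.N (n - ℓ + i)) - M₂ * P.δ (n - ℓ + i) / (Real.pi * P.N (n - ℓ + i)))) *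
          (2 * Real.exp (-(M₂ ^ 2 / 2))))) ≤ EV)
    (hEH : (1 + P.γ) * EV + P.γ * (2 * Real.exp (-(M₂ ^ 2 / 2))) * ((1 + P.γ + P.γ ^ 2) ^ n + EV) ≤ EH)
    (hζV : ∀ j, j < n → M₂ * P.δ j / (2 * Real.pi * P.N j) + EV ≤ M₁ * P.δ j / (2 * Real.pi * P.N j))
    (hζH : ∀ j, j < n → M₂ * P.δ j / (2 * Real.pi * P.N j) + EH ≤ M₁ * P.δ j / (2 * Real.pi * P.N j))
    (hB0 : ((P.γ ^ 2 - 3) ^ n)⁻¹ ≤ B 0)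
    (hB : ∀ ℓ, ℓ < n → 4 * B ℓ + 2 * P.N (n - ℓ - 1) * (P.γ + 2 + 2 / P.γ) / (P.γ ^ 2 - 3) ^ (n - ℓ) ≤ B (ℓ + 1))
    (Bad : Set (UnitAddTorus (Fin 2))) (hBadm : MeasurableSet Bad)
    (hBad : ∀ (Y : EuclideanSpace ℝ (Fin 2)) (z : ℝ → ℕ → EuclideanSpace ℝ (Fin 2)),
      (∀ s, z s n = Y + s • EuclideanSpace.single 0 1) →
      (∀ s, ∀ j < n, z s j = shearMapLift 0 1 (amp ⟨P.U j, P.U_periodic j, P.contDiff_U (P.δ_pos hδ₀ hd j)⟩ P.γ)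
        (shearMapLift 1 0 (amp ⟨P.U j, P.U_periodic j, P.contDiff_U (P.δ_pos hδ₀ hd j)⟩ P.γ) (z s (j + 1)))) →
      ∀ s : ℝ, (∃ j', j' < n ∧ ∃ q : ℤ,
        |(z s (j' + 1)) 0 - ((q : ℝ) / 2 + 1 / 4) / P.N j'| < M₁ * P.δ j' / (2 * Real.pi * P.N j') + EV ∨
        |((z s (j' + 1)) 1 - P.γ * P.U j' ((z s (j' + 1)) 0)) - ((q : ℝ) / 2 + 1 / 4) / P.N j'| <
          M₁ * P.δ j' / (2 * Real.pi * P.N j') + EH) →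
        proj (Y + s • EuclideanSpace.single 0 1) ∈ Bad)
    (Y : EuclideanSpace ℝ (Fin 2)) (z : ℝ → ℕ → EuclideanSpace ℝ (Fin 2)) (hzn : ∀ s, z s n = Y + s • EuclideanSpace.single 0 1)
    (hz : ∀ s, ∀ j < n, z s j = shearMapLift 0 1 (amp ⟨P.U j, P.U_periodic j, P.contDiff_U (P.δ_pos hδ₀ hd j)⟩ P.γ)
      (shearMapLift 1 0 (amp ⟨P.U j, P.U_periodic j, P.contDiff_U (P.δ_pos hδ₀ hd j)⟩ P.γ) (z s (j + 1))))
    {m : ℝ} (hm : |m| < (P.γ ^ 2 - 3) ^ n) :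
    ‖∫ s in (0 : ℝ)..1, (Real.sin (2 * Real.pi * (z s 0) 0) : ℂ) * exp (-(2 * Real.pi * I * (m * s)))‖ ≤
      B n / (Real.pi * (1 - |m| / (P.γ ^ 2 - 3) ^ n)) + 2 * Real.pi * EV +
        axisAvg 0 (Bad.indicator fun _ => (1 : ℝ)) (proj Y) := by
  have hc := chord_sum_le_lt P hγ h8 hδ₀ hd hN₀ hρ hM₁ hM hMδ Y z hzn hz B hEV0 hEV hEH hζV hζH hB0 hB hm
  set NEAR : Set ℝ := {s : ℝ | ∃ j', j' < n ∧ ∃ q : ℤ,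
          |(z s (j' + 1)) 0 - ((q : ℝ) / 2 + 1 / 4) / P.N j'| < M₁ * P.δ j' / (2 * Real.pi * P.N j') + EV ∨
          |((z s (j' + 1)) 1 - P.γ * P.U j' ((z s (j' + 1)) 0)) - ((q : ℝ) / 2 + 1 / 4) / P.N j'| <
            M₁ * P.δ j' / (2 * Real.pi * P.N j') + EH} with hNEAR
  refine hc.trans ?_
  -- the section of `Bad` along the chord
  set S : Set ℝ := (fun s : ℝ => proj (Y + s • EuclideanSpace.single 0 1)) ⁻¹' Bad with hS
  have hg : Continuous fun s : ℝ => proj (Y + s • EuclideanSpace.single (0 : Fin 2) (1 : ℝ)) :=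
    continuous_proj.comp (by fun_prop)
  have hSm : MeasurableSet S := hBadm.preimage hg.measurable
  have hsub : NEAR ∩ Icc (0 : ℝ) 1 ⊆ S ∩ Icc (0 : ℝ) 1 :=
    inter_subset_inter_left _ fun s hs => hBad Y z hzn hz s (by simpa only [hNEAR, mem_setOf_eq] using hs)
  have hax : axisAvg 0 (Bad.indicator fun _ => (1 : ℝ)) (proj Y) = volume.real (S ∩ Ioc (0 : ℝ) 1) := by
    have h := lift_axisAvg 0 (Bad.indicator fun _ => (1 : ℝ)) Y
    rw [lift_apply] at h
    rw [h, intervalIntegral.integral_of_le zero_le_one]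
    have hind : ∀ s, lift (Bad.indicator fun _ => (1 : ℝ)) (Y + s • EuclideanSpace.single 0 1) =
        S.indicator (fun _ => (1 : ℝ)) s := by
      intro s
      rw [lift_apply, hS]
      exact (Set.indicator_comp_right (fun s : ℝ => proj (Y + s • EuclideanSpace.single 0 1)) (g := fun _ => (1 : ℝ))
        (s := Bad) (x := s)).symm
    simp_rw [hind]
    rw [setIntegral_indicator hSm, setIntegral_const, smul_eq_mul, mul_one, inter_comm]
  have hvol : (volume (NEAR ∩ Icc (0 : ℝ) 1)).toReal ≤ axisAvg 0 (Bad.indicator fun _ => (1 : ℝ)) (proj Y) := by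
    rw [hax, Measure.real, measure_congr ((ae_eq_refl S).inter (Ioc_ae_eq_Icc (μ := volume)))]
    have hfin : volume (S ∩ Icc (0 : ℝ) 1) ≠ ⊤ :=
      (lt_of_le_of_lt (measure_mono inter_subset_right) (by rw [Real.volume_Icc]; exact ENNReal.ofReal_lt_top)).ne
    exact ENNReal.toReal_mono hfin (measure_mono hsub)
  linarith

/-- **The horizontal line means of the inviscid iterate** (column `{k₀ = 0}` of memo v8 §5): for every `x ∈ 𝕋²`,
`|axisAvg 0 (a_n) x| ≤ B_n/π + 2πE_V + axisAvg 0 1_{Bad} x`. [cite: ElgindiLissMattingly2025, §1.2.2, §3.1] -/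
theorem abs_axisAvg_iterate_le_lt (hγ : 1 ≤ P.γ) (h8 : 8 ≤ P.γ ^ 2) (hδ₀ : 0 < P.δ₀) (hd : 0 < P.d) (hN₀ : 1 ≤ P.N₀) (hρ : 1 ≤ P.ρN)
    {M₁ M₂ : ℝ} (hM₁ : 0 < M₁) (hM : 1 ≤ M₂) (hMδ : ∀ j, M₂ * P.δ j < Real.pi / 2) {n : ℕ}
    (a b : ℕ → UnitAddTorus (Fin 2) → ℝ) (h0 : a 0 = datum)
    (hb : ∀ j, b j = a j ∘ shearMap 0 1 (amp ⟨P.U j, P.U_periodic j, P.contDiff_U (P.δ_pos hδ₀ hd j)⟩ P.γ))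
    (hab : ∀ j, a (j + 1) = b j ∘ shearMap 1 0 (amp ⟨P.U j, P.U_periodic j, P.contDiff_U (P.δ_pos hδ₀ hd j)⟩ P.γ))
    {EV EH : ℝ} (B : ℕ → ℝ) (hEV0 : 0 ≤ EV)
    (hEV : ∀ ℓ, ℓ ≤ n → (∑ i ∈ Finset.range ℓ, (1 + P.γ + P.γ ^ 2) ^ i *
        ((P.γ ^ 2 * (1 / (2 * P.N (n - ℓ + i)) - M₂ * P.δ (n - ℓ + i) / (Real.pi * P.N (n - ℓ + i))) +
          P.γ * (1 / (2 * P.N (n - ℓ + i)) - M₂ * P.δ (n - ℓ + i) / (Real.pi * P.N (n - ℓ + i)))) *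
          (2 * Real.exp (-(M₂ ^ 2 / 2))))) ≤ EV)
    (hEH : (1 + P.γ) * EV + P.γ * (2 * Real.exp (-(M₂ ^ 2 / 2))) * ((1 + P.γ + P.γ ^ 2) ^ n + EV) ≤ EH)
    (hζV : ∀ j, j < n → M₂ * P.δ j / (2 * Real.pi * P.N j) + EV ≤ M₁ * P.δ j / (2 * Real.pi * P.N j))
    (hζH : ∀ j, j < n → M₂ * P.δ j / (2 * Real.pi * P.N j) + EH ≤ M₁ * P.δ j / (2 * Real.pi * P.N j))
    (hB0 : ((P.γ ^ 2 - 3) ^ n)⁻¹ ≤ B 0)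
    (hB : ∀ ℓ, ℓ < n → 4 * B ℓ + 2 * P.N (n - ℓ - 1) * (P.γ + 2 + 2 / P.γ) / (P.γ ^ 2 - 3) ^ (n - ℓ) ≤ B (ℓ + 1))
    (Bad : Set (UnitAddTorus (Fin 2))) (hBadm : MeasurableSet Bad)
    (hBad : ∀ (Y : EuclideanSpace ℝ (Fin 2)) (z : ℝ → ℕ → EuclideanSpace ℝ (Fin 2)),
      (∀ s, z s n = Y + s • EuclideanSpace.single 0 1) →
      (∀ s, ∀ j < n, z s j = shearMapLift 0 1 (amp ⟨P.U j, P.U_periodic j, P.contDiff_U (P.δ_pos hδ₀ hd j)⟩ P.γ)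
        (shearMapLift 1 0 (amp ⟨P.U j, P.U_periodic j, P.contDiff_U (P.δ_pos hδ₀ hd j)⟩ P.γ) (z s (j + 1)))) →
      ∀ s : ℝ, (∃ j', j' < n ∧ ∃ q : ℤ,
        |(z s (j' + 1)) 0 - ((q : ℝ) / 2 + 1 / 4) / P.N j'| < M₁ * P.δ j' / (2 * Real.pi * P.N j') + EV ∨
        |((z s (j' + 1)) 1 - P.γ * P.U j' ((z s (j' + 1)) 0)) - ((q : ℝ) / 2 + 1 / 4) / P.N j'| <
          M₁ * P.δ j' / (2 * Real.pi * P.N j') + EH) →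
        proj (Y + s • EuclideanSpace.single 0 1) ∈ Bad) (x : UnitAddTorus (Fin 2)) :
    |axisAvg 0 (a n) x| ≤ B n / Real.pi + 2 * Real.pi * EV + axisAvg 0 (Bad.indicator fun _ => (1 : ℝ)) x := by
  have hg3 : 0 < P.γ ^ 2 - 3 := by nlinarith
  obtain ⟨Y, rfl⟩ := proj_surjective x
  obtain ⟨z, hzn, hz⟩ := exists_traj P hδ₀ hd n Y
  -- the line mean is the chord integral of the phase
  have hmean : axisAvg 0 (a n) (proj Y) = ∫ s in (0 : ℝ)..1, Real.sin (2 * Real.pi * (z s 0) 0) := by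
    have h := lift_axisAvg 0 (a n) Y
    rw [lift_apply] at h
    rw [h]
    refine intervalIntegral.integral_congr fun s _ => ?_
    simp only [lift_apply]
    rw [← hzn s]
    exact iterate_proj_eq_sin P hδ₀ hd a b h0 hb hab n (z s) fun j hj => hz s j hj
  have hcx : (((∫ s in (0 : ℝ)..1, Real.sin (2 * Real.pi * (z s 0) 0)) : ℝ) : ℂ) =
      ∫ s in (0 : ℝ)..1, (Real.sin (2 * Real.pi * (z s 0) 0) : ℂ) * exp (-(2 * Real.pi * I * ((0 : ℝ) * s))) := by
    rw [← intervalIntegral.integral_ofReal]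
    refine intervalIntegral.integral_congr fun s _ => ?_
    simp
  have h := chord_sum_le_axisAvg_lt P hγ h8 hδ₀ hd hN₀ hρ hM₁ hM hMδ B hEV0 hEV hEH hζV hζH hB0 hB Bad hBadm hBad
    Y z hzn hz (m := 0) (by rw [abs_zero]; exact pow_pos hg3 n)
  rw [abs_zero, zero_div, sub_zero, mul_one, ← hcx, Complex.norm_real, Real.norm_eq_abs, ← hmean] at h
  exact h

/-- **The off-column Fourier coefficients of the inviscid iterate** (rest set of memo v8 §5): for `k₀ ≠ 0`, `|k₀| < (γ²−3)^n`,
`‖𝓕(a_n)(k)‖ ≤ B_n/(π(1 − |k₀|(γ²−3)^{−n})) + 2πE_V + vol(Bad)` (Fubini along `e₀`, the chord sum with `m = k₀`).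
[cite: ElgindiLissMattingly2025, §1.2.2, §3.1] [cite: Grafakos2014, Prop. 3.1.2] -/
theorem norm_mFourierCoeff_iterate_le_lt (hγ : 1 ≤ P.γ) (h8 : 8 ≤ P.γ ^ 2) (hδ₀ : 0 < P.δ₀) (hd : 0 < P.d) (hN₀ : 1 ≤ P.N₀) (hρ : 1 ≤ P.ρN)
    {M₁ M₂ : ℝ} (hM₁ : 0 < M₁) (hM : 1 ≤ M₂) (hMδ : ∀ j, M₂ * P.δ j < Real.pi / 2) {n : ℕ}
    (a b : ℕ → UnitAddTorus (Fin 2) → ℝ) (h0 : a 0 = datum)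
    (hb : ∀ j, b j = a j ∘ shearMap 0 1 (amp ⟨P.U j, P.U_periodic j, P.contDiff_U (P.δ_pos hδ₀ hd j)⟩ P.γ))
    (hab : ∀ j, a (j + 1) = b j ∘ shearMap 1 0 (amp ⟨P.U j, P.U_periodic j, P.contDiff_U (P.δ_pos hδ₀ hd j)⟩ P.γ))
    {EV EH : ℝ} (B : ℕ → ℝ) (hEV0 : 0 ≤ EV)
    (hEV : ∀ ℓ, ℓ ≤ n → (∑ i ∈ Finset.range ℓ, (1 + P.γ + P.γ ^ 2) ^ i *
        ((P.γ ^ 2 * (1 / (2 * P.N (n - ℓ + i)) - M₂ * P.δ (n - ℓ + i) / (Real.pi * P.N (n - ℓ + i))) +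
          P.γ * (1 / (2 * P.N (n - ℓ + i)) - M₂ * P.δ (n - ℓ + i) / (Real.pi * P.N (n - ℓ + i)))) *
          (2 * Real.exp (-(M₂ ^ 2 / 2))))) ≤ EV)
    (hEH : (1 + P.γ) * EV + P.γ * (2 * Real.exp (-(M₂ ^ 2 / 2))) * ((1 + P.γ + P.γ ^ 2) ^ n + EV) ≤ EH)
    (hζV : ∀ j, j < n → M₂ * P.δ j / (2 * Real.pi * P.N j) + EV ≤ M₁ * P.δ j / (2 * Real.pi * P.N j))
    (hζH : ∀ j, j < n → M₂ * P.δ j / (2 * Real.pi * P.N j) + EH ≤ M₁ * P.δ j / (2 * Real.pi * P.N j))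
    (hB0 : ((P.γ ^ 2 - 3) ^ n)⁻¹ ≤ B 0)
    (hB : ∀ ℓ, ℓ < n → 4 * B ℓ + 2 * P.N (n - ℓ - 1) * (P.γ + 2 + 2 / P.γ) / (P.γ ^ 2 - 3) ^ (n - ℓ) ≤ B (ℓ + 1))
    (Bad : Set (UnitAddTorus (Fin 2))) (hBadm : MeasurableSet Bad)
    (hBad : ∀ (Y : EuclideanSpace ℝ (Fin 2)) (z : ℝ → ℕ → EuclideanSpace ℝ (Fin 2)),
      (∀ s, z s n = Y + s • EuclideanSpace.single 0 1) →
      (∀ s, ∀ j < n, z s j = shearMapLift 0 1 (amp ⟨P.U j, P.U_periodic j, P.contDiff_U (P.δ_pos hδ₀ hd j)⟩ P.γ)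
        (shearMapLift 1 0 (amp ⟨P.U j, P.U_periodic j, P.contDiff_U (P.δ_pos hδ₀ hd j)⟩ P.γ) (z s (j + 1)))) →
      ∀ s : ℝ, (∃ j', j' < n ∧ ∃ q : ℤ,
        |(z s (j' + 1)) 0 - ((q : ℝ) / 2 + 1 / 4) / P.N j'| < M₁ * P.δ j' / (2 * Real.pi * P.N j') + EV ∨
        |((z s (j' + 1)) 1 - P.γ * P.U j' ((z s (j' + 1)) 0)) - ((q : ℝ) / 2 + 1 / 4) / P.N j'| <
          M₁ * P.δ j' / (2 * Real.pi * P.N j') + EH) →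
        proj (Y + s • EuclideanSpace.single 0 1) ∈ Bad) (has : ∀ j, IsSmooth (a j))
    (k : Fin 2 → ℤ) (hk : |((k 0 : ℤ) : ℝ)| < (P.γ ^ 2 - 3) ^ n) :
    ‖mFourierCoeff (fun x => (a n x : ℂ)) k‖ ≤
      B n / (Real.pi * (1 - |((k 0 : ℤ) : ℝ)| / (P.γ ^ 2 - 3) ^ n)) + 2 * Real.pi * EV + (volume Bad).toReal := by
  set F : UnitAddTorus (Fin 2) → ℂ := fun x => mFourier (-k) x * (a n x : ℂ) with hF
  have hFc : Continuous F := (mFourier (-k)).continuous.mul (continuous_ofReal.comp (has n).continuous)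
  have hFi : Integrable F volume := hFc.integrable_of_hasCompactSupport (HasCompactSupport.of_compactSpace _)
  have hcoef : mFourierCoeff (fun x => (a n x : ℂ)) k = ∫ x, axisAvg 0 F x := by
    rw [← integral_eq_integral_axisAvg 0 hFi, mFourierCoeff_eq_integral_volume]
    rfl
  -- pointwise bound of the line means of `F`
  set h : UnitAddTorus (Fin 2) → ℝ := axisAvg 0 (Bad.indicator fun _ => (1 : ℝ)) with hh
  set C : ℝ := B n / (Real.pi * (1 - |((k 0 : ℤ) : ℝ)| / (P.γ ^ 2 - 3) ^ n)) + 2 * Real.pi * EV with hC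
  have hpt : ∀ x, ‖axisAvg 0 F x‖ ≤ C + h x := by
    intro x
    obtain ⟨Y, rfl⟩ := proj_surjective x
    obtain ⟨z, hzn, hz⟩ := exists_traj P hδ₀ hd n Y
    have hnorm : ∀ y : UnitAddTorus (Fin 2), ‖mFourier (-k) y‖ = 1 := fun y => by
      simp only [mFourier, ContinuousMap.coe_mk, norm_prod]
      exact Finset.prod_eq_one fun i _ => by simp
    rw [hF, axisAvg_char_mul_eq P hδ₀ hd a b h0 hb hab n k Y z hzn hz, norm_mul, hnorm, one_mul]
    exact chord_sum_le_axisAvg_lt P hγ h8 hδ₀ hd hN₀ hρ hM₁ hM hMδ B hEV0 hEV hEH hζV hζH hB0 hB Bad hBadm hBad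
      Y z hzn hz hk
  -- the section function `h`: measurable, `0 ≤ h ≤ 1`, `∫ h = vol(Bad)`
  have hind_i : Integrable (Bad.indicator fun _ => (1 : ℝ)) (volume : Measure (UnitAddTorus (Fin 2))) :=
    (integrable_const (1 : ℝ)).indicator hBadm
  have hh_meas : AEStronglyMeasurable h volume := aestronglyMeasurable_axisAvg hind_i.aestronglyMeasurable
  have hh_bdd : ∀ x, ‖h x‖ ≤ 1 := by
    intro x
    rw [hh, axisAvg_apply]
    have h1 : ‖∫ s : UnitAddCircle, Bad.indicator (fun _ => (1 : ℝ)) (x + Pi.single 0 s)‖ ≤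
        1 * (volume : Measure UnitAddCircle).real univ := by
      refine norm_integral_le_of_norm_le_const (Filter.Eventually.of_forall fun s => ?_)
      rw [Real.norm_eq_abs, abs_le]
      by_cases hs : x + Pi.single 0 s ∈ Bad <;> simp [Set.indicator, hs]
    rwa [one_mul, probReal_univ] at h1
  have hh_i : Integrable h volume := Integrable.of_bound hh_meas 1 (Filter.Eventually.of_forall hh_bdd)
  have hh_int : ∫ x, h x = (volume Bad).toReal := by
    rw [hh, ← integral_eq_integral_axisAvg 0 hind_i, MeasureTheory.integral_indicator hBadm, setIntegral_const, smul_eq_mul, mul_one,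
      measureReal_def]
  have hax_i : Integrable (fun x => ‖axisAvg 0 F x‖) volume :=
    (Integrable.of_bound (aestronglyMeasurable_axisAvg hFi.aestronglyMeasurable) (C + 1)
      (Filter.Eventually.of_forall fun x => (hpt x).trans (by linarith [hh_bdd x, Real.norm_eq_abs (h x), le_abs_self (h x)]))).norm
  calc ‖mFourierCoeff (fun x => (a n x : ℂ)) k‖ = ‖∫ x, axisAvg 0 F x‖ := by rw [hcoef]
    _ ≤ ∫ x, ‖axisAvg 0 F x‖ := norm_integral_le_integral_norm _
    _ ≤ ∫ x, (C + h x) := integral_mono hax_i ((integrable_const C).add hh_i) hpt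
    _ = C + (volume Bad).toReal := by
        rw [integral_add (integrable_const C) hh_i, MeasureTheory.integral_const, hh_int, probReal_univ, one_smul]

end Means

end Summit.AnomalousDissipation.AnomalousDissipation.Theorems.SawtoothPulseCascade.K1Start
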